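import Literature.RepresentationTheory.BorelWallach2000.TrivialModuleGKCohomologyUnitary
import HarnessLib

/-!
# The maximal compact subgroup `K = U(α) × U(β)` of `U(α, β)` IN BLOCKS: the block projections as continuous homomorphisms,
# the isomorphism of topological groups `K ≃ₜ* U(α) × U(β)`, and `Ad(k)` on `𝔭` in blocks

Topic `RepresentationTheory/BorelWallach2000`; namespace `Literature.RepresentationTheory.BorelWallach2000` (sequel of ★
`TrivialModuleGKCohomologyUnitary`, whose ★ `upq_K_blocks` says that an element of `K := (uFormGroup α β).maximalCompact` is block
diagonal with unitary diagonal blocks, and of ★ `KonnoKonno2007/RealUnitaryDualPair` §1, whose ★ `kV : U(α) × U(β) →* U(α, β)`,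
`(a, d) ↦ diag(a, d)`, is the inverse direction, ★ `upq_kV_mem_maximalCompact`).  Honest DEFINITIONS (two monoid homomorphisms and one
`ContinuousMulEquiv`, all with bodies) + theorems; no instance, no notation, no named fact, no `sorry`.  Generic `U(α, β)`.

* `upqKBlock₁ : K →* Matrix.unitaryGroup α ℂ`, `upqKBlock₂ : K →* Matrix.unitaryGroup β ℂ` — the diagonal blocks `k ↦ k₁₁`, `k ↦ k₂₂`
  (multiplicative because the off-diagonal blocks vanish, ★ `upq_K_blocks`); `continuous_upqKBlock₁` ∕ `continuous_upqKBlock₂`.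
* `coe_eq_fromBlocks_upqKBlock` — `k = diag(k₁₁, k₂₂)`; `kV_upqKBlock` ∕ `upqKBlock₁_kV` ∕ `upqKBlock₂_kV` — `kV` and the blocks are inverse.
* **`upqMaximalCompactEquiv : K ≃ₜ* Matrix.unitaryGroup α ℂ × Matrix.unitaryGroup β ℂ`** — the isomorphism of TOPOLOGICAL groups
  `K = U(α) × U(β)` ([BorelWallach2000, VI 4.7]: «`K = U(n+1) ∩ G`»; [Knapp2002, I §1 Example (3), VI §2]); inverse `(a, d) ↦ kV (a, d)`.
* `upq_Ad_offDiag` — **`Ad(k) X_B = X_{k₁₁ B k₂₂ᴴ}`** for EVERY `k ∈ K` (★ `upq_Ad_kV_offDiag` was stated for `k = kV (a, d)`): the isotropy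
  representation of `K` on `𝔭 ≅ M_{α×β}(ℂ)` is `B ↦ k₁₁ B k₂₂⁻¹` ([BorelWallach2000, VI 4.8 (3)]: «as a representation of `K`, `𝔤_c ⁄ 𝔨_c` is
  `τ₁ ⊕ τ₁^*`»).
Consumer: the `hodgecm-mathlib` line `Cruxes/H413/Lines/F0_LocalAPackets.lean`, waypoint W1 of `stub_T3aRealisationDatum` (the `K`-action
`ρK k := χ(k₂₂) • Sym^{n−1}(k₁₁)` of the ladder representations of `U(2,1)` is a continuous homomorphism by composition with these blocks).
HC_CM is proved only modulo the printed citations until rung 0 closes; this file is a generic leaf and changes no count.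

## References
* [BorelWallach2000] A. Borel, N. Wallach, *Continuous Cohomology, Discrete Subgroups, and Representations of Reductive Groups*, 2nd ed.
  (2000), VI 4.7–4.8.
* [Knapp2002] A. W. Knapp, *Lie Groups Beyond an Introduction*, 2nd ed. (2002), I §1 Example (3); VI §2.
* [KonnoKonno2007] K. Konno, T. Konno, §3.1 (the pair `(U(p,q), U(1))`, `K = U(p) × U(q)`).
-/

set_option autoImplicit false

noncomputable section

open scoped Matrix MatrixGroups ComplexConjugate

namespace Literature.RepresentationTheory.BorelWallach2000

open Literature.NumberTheory.Automorphic
open Literature.RepresentationTheory.KonnoKonno2007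
open Literature.RepresentationTheory.KonnoKonno2007.RealDualPair
open Literature.RepresentationTheory.KonnoKonno2007.RealDualPair.UForm

variable {α β : Type*} [Fintype α] [DecidableEq α] [Fintype β] [DecidableEq β]

/-! ## §1 The diagonal blocks of `K` as homomorphisms into `U(α)`, `U(β)` -/

/-- The underlying matrix of `k ∈ K` is block diagonal: `k = diag(k₁₁, k₂₂)` (★ `upq_K_blocks`). [cite: BorelWallach2000, VI 4.7] -/
theorem coe_eq_fromBlocks (k : (uFormGroup α β).maximalCompact) :
    ((k : GL (α ⊕ β) ℂ) : Matrix (α ⊕ β) (α ⊕ β) ℂ) =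
      Matrix.fromBlocks ((k : GL (α ⊕ β) ℂ) : Matrix (α ⊕ β) (α ⊕ β) ℂ).toBlocks₁₁ 0 0
        ((k : GL (α ⊕ β) ℂ) : Matrix (α ⊕ β) (α ⊕ β) ℂ).toBlocks₂₂ := by
  obtain ⟨h12, h21, -⟩ := upq_K_blocks k
  conv_lhs => rw [← Matrix.fromBlocks_toBlocks ((k : GL (α ⊕ β) ℂ) : Matrix (α ⊕ β) (α ⊕ β) ℂ)]
  rw [h12, h21]

/-- The `α`-block of a product is the product of the `α`-blocks (off-diagonal blocks vanish). [cite: BorelWallach2000, VI 4.7] -/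
theorem toBlocks₁₁_mul (k k' : (uFormGroup α β).maximalCompact) :
    (((k * k' : (uFormGroup α β).maximalCompact) : GL (α ⊕ β) ℂ) : Matrix (α ⊕ β) (α ⊕ β) ℂ).toBlocks₁₁ =
      ((k : GL (α ⊕ β) ℂ) : Matrix (α ⊕ β) (α ⊕ β) ℂ).toBlocks₁₁ * ((k' : GL (α ⊕ β) ℂ) : Matrix (α ⊕ β) (α ⊕ β) ℂ).toBlocks₁₁ := by
  rw [Subgroup.coe_mul, Units.val_mul, coe_eq_fromBlocks k, coe_eq_fromBlocks k', Matrix.fromBlocks_multiply]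
  simp only [Matrix.mul_zero, Matrix.zero_mul, add_zero, Matrix.toBlocks_fromBlocks₁₁]

/-- The `β`-block of a product is the product of the `β`-blocks. [cite: BorelWallach2000, VI 4.7] -/
theorem toBlocks₂₂_mul (k k' : (uFormGroup α β).maximalCompact) :
    (((k * k' : (uFormGroup α β).maximalCompact) : GL (α ⊕ β) ℂ) : Matrix (α ⊕ β) (α ⊕ β) ℂ).toBlocks₂₂ =
      ((k : GL (α ⊕ β) ℂ) : Matrix (α ⊕ β) (α ⊕ β) ℂ).toBlocks₂₂ * ((k' : GL (α ⊕ β) ℂ) : Matrix (α ⊕ β) (α ⊕ β) ℂ).toBlocks₂₂ := by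
  rw [Subgroup.coe_mul, Units.val_mul, coe_eq_fromBlocks k, coe_eq_fromBlocks k', Matrix.fromBlocks_multiply]
  simp only [Matrix.mul_zero, Matrix.zero_mul, zero_add, Matrix.toBlocks_fromBlocks₂₂]

/-- **The `α`-block `K →* U(α)`, `k ↦ k₁₁`** (unitary by ★ `upq_K_blocks`, multiplicative by `toBlocks₁₁_mul`).
[cite: BorelWallach2000, VI 4.7] [cite: Knapp2002, I §1 Example (3)] -/
def upqKBlock₁ : (uFormGroup α β).maximalCompact →* Matrix.unitaryGroup α ℂ where
  toFun k := ⟨((k : GL (α ⊕ β) ℂ) : Matrix (α ⊕ β) (α ⊕ β) ℂ).toBlocks₁₁, by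
    rw [Matrix.mem_unitaryGroup_iff, Matrix.star_eq_conjTranspose]
    exact (upq_K_blocks k).2.2.2.1⟩
  map_one' := by
    apply Subtype.ext
    change (((1 : (uFormGroup α β).maximalCompact) : GL (α ⊕ β) ℂ) : Matrix (α ⊕ β) (α ⊕ β) ℂ).toBlocks₁₁ = 1
    rw [Subgroup.coe_one, Units.val_one, ← Matrix.fromBlocks_one, Matrix.toBlocks_fromBlocks₁₁]
  map_mul' k k' := Subtype.ext (toBlocks₁₁_mul k k')

/-- **The `β`-block `K →* U(β)`, `k ↦ k₂₂`.** [cite: BorelWallach2000, VI 4.7] [cite: Knapp2002, I §1 Example (3)] -/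
def upqKBlock₂ : (uFormGroup α β).maximalCompact →* Matrix.unitaryGroup β ℂ where
  toFun k := ⟨((k : GL (α ⊕ β) ℂ) : Matrix (α ⊕ β) (α ⊕ β) ℂ).toBlocks₂₂, by
    rw [Matrix.mem_unitaryGroup_iff, Matrix.star_eq_conjTranspose]
    exact (upq_K_blocks k).2.2.2.2.2⟩
  map_one' := by
    apply Subtype.ext
    change (((1 : (uFormGroup α β).maximalCompact) : GL (α ⊕ β) ℂ) : Matrix (α ⊕ β) (α ⊕ β) ℂ).toBlocks₂₂ = 1
    rw [Subgroup.coe_one, Units.val_one, ← Matrix.fromBlocks_one, Matrix.toBlocks_fromBlocks₂₂]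
  map_mul' k k' := Subtype.ext (toBlocks₂₂_mul k k')

/-- `upqKBlock₁ k` is the matrix block `k₁₁`. [cite: BorelWallach2000, VI 4.7] -/
@[simp] theorem coe_upqKBlock₁ (k : (uFormGroup α β).maximalCompact) :
    ((upqKBlock₁ k : Matrix.unitaryGroup α ℂ) : Matrix α α ℂ) = ((k : GL (α ⊕ β) ℂ) : Matrix (α ⊕ β) (α ⊕ β) ℂ).toBlocks₁₁ := rfl

/-- `upqKBlock₂ k` is the matrix block `k₂₂`. [cite: BorelWallach2000, VI 4.7] -/
@[simp] theorem coe_upqKBlock₂ (k : (uFormGroup α β).maximalCompact) :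
    ((upqKBlock₂ k : Matrix.unitaryGroup β ℂ) : Matrix β β ℂ) = ((k : GL (α ⊕ β) ℂ) : Matrix (α ⊕ β) (α ⊕ β) ℂ).toBlocks₂₂ := rfl

/-- `k = diag(upqKBlock₁ k, upqKBlock₂ k)` as matrices. [cite: BorelWallach2000, VI 4.7] -/
theorem coe_eq_fromBlocks_upqKBlock (k : (uFormGroup α β).maximalCompact) :
    ((k : GL (α ⊕ β) ℂ) : Matrix (α ⊕ β) (α ⊕ β) ℂ) =
      Matrix.fromBlocks ((upqKBlock₁ k : Matrix.unitaryGroup α ℂ) : Matrix α α ℂ) 0 0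
        ((upqKBlock₂ k : Matrix.unitaryGroup β ℂ) : Matrix β β ℂ) :=
  coe_eq_fromBlocks k

/-- The block projection `k ↦ k₁₁` is continuous (a coordinate projection of the matrix entries; `K` carries the subspace topology of
`GL_{α ⊕ β}(ℂ)`). [cite: Knapp2002, I §1 Example (3)] -/
theorem continuous_upqKBlock₁ : Continuous (upqKBlock₁ : (uFormGroup α β).maximalCompact → Matrix.unitaryGroup α ℂ) := by
  refine Continuous.subtype_mk ?_ _
  exact (Units.continuous_val.comp continuous_subtype_val).matrix_submatrix Sum.inl Sum.inl

/-- The block projection `k ↦ k₂₂` is continuous. [cite: Knapp2002, I §1 Example (3)] -/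
theorem continuous_upqKBlock₂ : Continuous (upqKBlock₂ : (uFormGroup α β).maximalCompact → Matrix.unitaryGroup β ℂ) := by
  refine Continuous.subtype_mk ?_ _
  exact (Units.continuous_val.comp continuous_subtype_val).matrix_submatrix Sum.inr Sum.inr

/-! ## §2 `kV` and the blocks are mutually inverse; the isomorphism `K ≃ₜ* U(α) × U(β)` -/

/-- `kV (k₁₁, k₂₂) = k` in `GL_{α ⊕ β}(ℂ)`. [cite: KonnoKonno2007, §3.1] -/
theorem kV_upqKBlock (k : (uFormGroup α β).maximalCompact) :
    ((kV α β (upqKBlock₁ k, upqKBlock₂ k) : UForm α β) : GL (α ⊕ β) ℂ) = (k : GL (α ⊕ β) ℂ) :=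
  Units.ext (by rw [coe_kV, ← coe_eq_fromBlocks_upqKBlock])

/-- `(kV (a, d))₁₁ = a`. [cite: KonnoKonno2007, §3.1] -/
theorem upqKBlock₁_kV (a : Matrix.unitaryGroup α ℂ) (d : Matrix.unitaryGroup β ℂ) :
    upqKBlock₁ (⟨_, upq_kV_mem_maximalCompact a d⟩ : (uFormGroup α β).maximalCompact) = a :=
  Subtype.ext (by rw [coe_upqKBlock₁]; change (((kV α β (a, d) : UForm α β) : GL (α ⊕ β) ℂ) : Matrix (α ⊕ β) (α ⊕ β) ℂ).toBlocks₁₁ = _;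
                   rw [coe_kV, Matrix.toBlocks_fromBlocks₁₁])

/-- `(kV (a, d))₂₂ = d`. [cite: KonnoKonno2007, §3.1] -/
theorem upqKBlock₂_kV (a : Matrix.unitaryGroup α ℂ) (d : Matrix.unitaryGroup β ℂ) :
    upqKBlock₂ (⟨_, upq_kV_mem_maximalCompact a d⟩ : (uFormGroup α β).maximalCompact) = d :=
  Subtype.ext (by rw [coe_upqKBlock₂]; change (((kV α β (a, d) : UForm α β) : GL (α ⊕ β) ℂ) : Matrix (α ⊕ β) (α ⊕ β) ℂ).toBlocks₂₂ = _;
                   rw [coe_kV, Matrix.toBlocks_fromBlocks₂₂])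

/-- **`K = U(α) × U(β)` as TOPOLOGICAL GROUPS**: the maximal compact subgroup `K = U(α,β) ∩ U(α ⊕ β)` of `U(α, β)` is isomorphic, as a
topological group, to `U(α) × U(β)` by `k ↦ (k₁₁, k₂₂)`, with inverse `(a, d) ↦ diag(a, d) = kV (a, d)` (★ `continuous_kV`).
[cite: BorelWallach2000, VI 4.7] [cite: Knapp2002, VI §2] [cite: KonnoKonno2007, §3.1] -/
def upqMaximalCompactEquiv : (uFormGroup α β).maximalCompact ≃ₜ* Matrix.unitaryGroup α ℂ × Matrix.unitaryGroup β ℂ where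
  toFun k := (upqKBlock₁ k, upqKBlock₂ k)
  invFun p := ⟨_, upq_kV_mem_maximalCompact p.1 p.2⟩
  left_inv k := Subtype.ext (kV_upqKBlock k)
  right_inv p := Prod.ext (upqKBlock₁_kV p.1 p.2) (upqKBlock₂_kV p.1 p.2)
  map_mul' k k' := Prod.ext (map_mul upqKBlock₁ k k') (map_mul upqKBlock₂ k k')
  continuous_toFun := continuous_upqKBlock₁.prodMk continuous_upqKBlock₂
  continuous_invFun := by
    refine Continuous.subtype_mk ?_ _
    exact continuous_subtype_val.comp (continuous_kV.comp (continuous_fst.prodMk continuous_snd))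

/-- `upqMaximalCompactEquiv k = (k₁₁, k₂₂)`. [cite: BorelWallach2000, VI 4.7] -/
@[simp] theorem upqMaximalCompactEquiv_apply (k : (uFormGroup α β).maximalCompact) :
    upqMaximalCompactEquiv k = (upqKBlock₁ k, upqKBlock₂ k) := rfl

/-- `upqMaximalCompactEquiv⁻¹ (a, d) = kV (a, d)` in `GL_{α ⊕ β}(ℂ)`. [cite: KonnoKonno2007, §3.1] -/
@[simp] theorem coe_upqMaximalCompactEquiv_symm_apply (p : Matrix.unitaryGroup α ℂ × Matrix.unitaryGroup β ℂ) :
    ((upqMaximalCompactEquiv.symm p : (uFormGroup α β).maximalCompact) : GL (α ⊕ β) ℂ) = ((kV α β p : UForm α β) : GL (α ⊕ β) ℂ) := rfl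

/-! ## §3 `Ad(k)` on the off-diagonal block `𝔭` for every `k ∈ K` -/

/-- `k ∈ K`, read in the carrier of `U(α, β)`, IS `kV (k₁₁, k₂₂)` there. [cite: KonnoKonno2007, §3.1] -/
theorem inclusion_eq_inclusion_kV (k : (uFormGroup α β).maximalCompact) :
    Subgroup.inclusion (uFormGroup α β).maximalCompact_le_carrier k =
      Subgroup.inclusion (uFormGroup α β).maximalCompact_le_carrier ⟨_, upq_kV_mem_maximalCompact (upqKBlock₁ k) (upqKBlock₂ k)⟩ :=
  Subtype.ext (kV_upqKBlock k).symm

/-- **`Ad(k) X_B = X_{k₁₁ B k₂₂ᴴ}` for every `k ∈ K`**: the isotropy representation of `K = U(α) × U(β)` on `𝔭 ≅ M_{α×β}(ℂ)`,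
`X_B = [[0, B], [Bᴴ, 0]]`, is `B ↦ k₁₁ B k₂₂⁻¹` (★ `upq_Ad_kV_offDiag` at `kV (k₁₁, k₂₂) = k`). [cite: BorelWallach2000, VI 4.8 (3)] -/
theorem upq_Ad_offDiag (k : (uFormGroup α β).maximalCompact) (B : Matrix α β ℂ) :
    (uFormGroup α β).Ad (Subgroup.inclusion (uFormGroup α β).maximalCompact_le_carrier k) ⟨Matrix.fromBlocks 0 B Bᴴ 0, upq_offDiag_mem_lie B⟩ =
      ⟨Matrix.fromBlocks 0 (((upqKBlock₁ k : Matrix.unitaryGroup α ℂ) : Matrix α α ℂ) * B * (((upqKBlock₂ k : Matrix.unitaryGroup β ℂ) : Matrix β β ℂ))ᴴ)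
        ((((upqKBlock₁ k : Matrix.unitaryGroup α ℂ) : Matrix α α ℂ) * B * (((upqKBlock₂ k : Matrix.unitaryGroup β ℂ) : Matrix β β ℂ))ᴴ))ᴴ 0,
        upq_offDiag_mem_lie _⟩ := by
  rw [inclusion_eq_inclusion_kV k]
  exact upq_Ad_kV_offDiag (upqKBlock₁ k) (upqKBlock₂ k) B

end Literature.RepresentationTheory.BorelWallach2000

end
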